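import Summits.SmoothPoincare4.SmoothPoincare4.Theorems.SblfDescentRungOneHelperDegreeCollar
import Summits.SmoothPoincare4.SmoothPoincare4.Theorems.SblfDescentRungOneHelperDegreeCollapse
import HarnessLib

/-!
# The degree of the angular loop of a rigid collar is `σ s₀ - w`

Helper layer `helper_degree_comparison` of the brick `helper_sliceGluing_vanishingDegree` (apex
leaf F0, the degree lemma) of line `Sketch`, crux `SblfDescent.RungOne`
(crux item stmt-SmoothPoincare4-18531).

Let `(ιC, aC, bC)` be rigid torus coordinates matched to the fold tube `ν` for the sign
`σ = ±1` (`IsRigidCollar f v ν σ arctan s₁ s₂ ε₂ ιC aC bC`), let `G` be the transverse angle map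
of the `ε'`-tube (`helper_degree_tube`: `circlePt (clamp (2x₂/ε'))` on the tube, the antipode
off it; `ε' ≤ ε₂`, `ε' ≤ ε`), and let `γ : ℝ → X` be a loop in the band at the height
`s ∈ (s₁, s₂)`, `s < 7ε'²/8`, whose longitude is `circlePt (s₀ t + α)` with `s₀ = ±1` (the base
circles of the torus-side product chart, `helper_degree_base`).  If `La` is a continuous lift of
`aC ∘ γ` with increment `k` (the degree of the angular loop) and `LG` one of `G ∘ γ` with
increment `w` (the transverse winding), then

  `k = σ s₀ - w`        (`helper_degree_comparison`, registered).

Proof: the function `D t = σ (s₀ t + α) - La t` is, modulo `ℤ`, the depth angle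
`arctan x₂ / 2π` at the points of `γ` in the tube (rigidity of `aC` and
`rigidDir σ θ (circlePt φ) = circlePt (σ φ - θ / 2π)`), and stays at distance
`≥ arctan (ε'/4) / 2π` from `ℤ` at the points of `γ` off the thin core of the tube (on the tube
by the size of `x₂`, off the tube by the fibre structure of the collar, `helper_degree_collar`).
Hence the collapse map `r` of `helper_degree_collapse` (`m₀ = ε'/4`) makes `r ∘ D` a continuous
lift of `G ∘ γ`; its increment `σ s₀ - k` is therefore `w`.

## References

* R. İ. Baykur, S. Kamada, *Classification of broken Lefschetz fibrations with small fiber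
  genera*, J. Math. Soc. Japan 67 (2015), §2, §5. [BaykurKamada2015]
* A. Hatcher, *Algebraic Topology* (2002), Thm. 1.7. [HatcherAT2002]
-/

set_option linter.dupNamespace false

noncomputable section

open scoped Manifold ContDiff Topology RealInnerProductSpace
open Set Function Literature.Topology.FourManifolds

namespace Summit.SmoothPoincare4.SmoothPoincare4.Cruxes.RungOne.Sketch

/-- `circlePt (n + 1/2) = circlePt (1/2)` for an integer `n`. [folklore] -/
theorem helper_degree_circlePt_int_add_half (n : ℤ) : circlePt (n + 1 / 2) = circlePt (1 / 2) := by
  rw [show (n : ℝ) + 1 / 2 = 1 / 2 + n by ring]; exact circlePt_add_int _ _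

/-- **The degree of the angular loop is `σ s₀ - w`** (registered layer E of the degree lemma
`helper_sliceGluing_vanishingDegree`).  Let `(ιC, aC, bC)` be a rigid collar for the sign `σ`,
`G` the transverse angle map on the `ε'`-tube (`ε' ≤ ε₂`, `ε' ≤ ε`), and `γ` a loop in the band
at height `s < 7ε'²/8` whose longitude is `circlePt (s₀ t + α)`, `s₀ = ±1`.  If `La` lifts
`aC ∘ γ` with increment `k` and `LG` lifts `G ∘ γ` with increment `w`, then `k = σ s₀ - w`:
the function `D = σ (s₀ t + α) - La` is, modulo `ℤ`, the depth angle `arctan x₂ / 2π` on the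
tube (rigidity) and stays at distance `≥ arctan (ε'/4) / 2π` from `ℤ` off the thin core
(`helper_degree_collar`), so the collapse map `r` (`helper_degree_collapse`) turns it into a lift
`r ∘ D` of `G ∘ γ`, of increment `σ s₀ - k`. [cite: BaykurKamada2015, §2, §5] -/
theorem helper_degree_comparison : ∀ (X : Type) [TopologicalSpace X] [ChartedSpace (EuclideanSpace ℝ (Fin 4)) X] (f : X → Metric.sphere (0 : EuclideanSpace ℝ (Fin 3)) 1) (v : Metric.sphere (0 : EuclideanSpace ℝ (Fin 3)) 1), (v : EuclideanSpace ℝ (Fin 3)) 0 = 0 → (v : EuclideanSpace ℝ (Fin 3)) 1 = 0 → ∀ (ε : ℝ) (ν : (Metric.sphere (0 : EuclideanSpace ℝ (Fin 2)) 1) × EuclideanSpace ℝ (Fin 3) → X), IsFoldTube f v ε ν → ∀ (σ s₁ s₂ ε₂ : ℝ) (ιC : ((Metric.sphere (0 : EuclideanSpace ℝ (Fin 2)) 1) × (Metric.sphere (0 : EuclideanSpace ℝ (Fin 2)) 1)) × ((Metric.sphere (0 : EuclideanSpace ℝ (Fin 2)) 1) × ℝ) → X) (aC bC : X → Metric.sphere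 (0 : EuclideanSpace ℝ (Fin 2)) 1), IsRigidCollar f v ν σ Real.arctan s₁ s₂ ε₂ ιC aC bC → (σ = 1 ∨ σ = -1) → ∀ (ε' : ℝ), 0 < ε' → ε' ≤ ε₂ → ε' ≤ ε → ∀ (G : X → Metric.sphere (0 : EuclideanSpace ℝ (Fin 2)) 1), (∀ (u : Metric.sphere (0 : EuclideanSpace ℝ (Fin 2)) 1) (y : EuclideanSpace ℝ (Fin 3)), y ∈ Metric.ball (0 : EuclideanSpace ℝ (Fin 3)) ε' → G (ν (u, y)) = circlePt (max (-1 / 2) (min (1 / 2) (2 * y 2 / ε')))) → (∀ p : X, p ∉ ν '' (Set.univ ×ˢ Metric.ball (0 : EuclideanSpace ℝ (Fin 3)) ε') → G p = circlePt (1 / 2)) → ∀ (γ : ℝ → X) (s c s₀ α : ℝ), (s₀ = 1 ∨ s₀ = -1) → s₁ < s → s < s₂ → s < 7 * ε' ^ 2 / 8 → 0 < c → (∀ t : ℝ, (v : EuclideanSpace ℝ (Fin 3)) 2 * ((f (γ t) : Metric.sphere (0 : EuclideanSpace ℝ (Fin 3)) 1) : EuclideanSpace ℝ (Fin 3)) 2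 = s) → (∀ t : ℝ, ((f (γ t) : Metric.sphere (0 : EuclideanSpace ℝ (Fin 3)) 1) : EuclideanSpace ℝ (Fin 3)) 0 = c * ((circlePt (s₀ * t + α) : Metric.sphere (0 : EuclideanSpace ℝ (Fin 2)) 1) : EuclideanSpace ℝ (Fin 2)) 0 ∧ ((f (γ t) : Metric.sphere (0 : EuclideanSpace ℝ (Fin 3)) 1) : EuclideanSpace ℝ (Fin 3)) 1 = c * ((circlePt (s₀ * t + α) : Metric.sphere (0 : EuclideanSpace ℝ (Fin 2)) 1) : EuclideanSpace ℝ (Fin 2)) 1) → ∀ (La LG : ℝ → ℝ) (k w : ℤ), Continuous La → Continuous LG → (∀ t, aC (γ t) = circlePt (La t)) → (∀ t, G (γ t) = circlePt (LG t)) → (∀ t, La (t + 1) = La t + k) → (∀ t, LG (t + 1) = LG t + w) → (k : ℝ) = σ * s₀ - w := by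
  intro X _ _ f v hv0 hv1 ε ν hT σ s₁ s₂ ε₂ ιC aC bC hC hσ ε' hε' hε'ε₂ hε'ε G hGt hGo γ s c s₀ α hs₀
    hs1 hs2 hs78 hc hlev hpl La LG k w hLa hLG hLal hLGl hk hw
  have hv2 := helper_degree_pole_sq v hv0 hv1
  have hπ := Real.pi_pos
  have hs0 : 0 < s := hC.pos.trans hs1
  have hε'1 : ε' < 1 := lt_of_le_of_lt hε'ε hT.lt_one
  have hsε' : s < ε' ^ 2 := by nlinarith
  have hs_lt_one : s < 1 := by nlinarith
  have h1s : 0 < 1 - s ^ 2 := by nlinarith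
  have hsq : 0 < √(1 - s ^ 2) := Real.sqrt_pos.2 h1s
  -- the collapse map for `m₀ = ε'/4`
  set m₀ : ℝ := ε' / 4 with hm₀
  have hm₀pos : 0 < m₀ := by positivity
  obtain ⟨r, hrc, hrk, hr_in, hr_out⟩ := helper_degree_collapse m₀ hm₀pos
  set w₁ : ℝ := Real.arctan m₀ / (2 * Real.pi) with hw₁
  have hw₁lt : w₁ < 1 / 4 := by
    rw [hw₁, div_lt_iff₀ (by positivity)]; linarith [Real.arctan_lt_pi_div_two m₀]
  -- integer forms of the signs
  obtain ⟨σz, hσz, hσz1⟩ : ∃ σz : ℤ, (σ = σz) ∧ (σz = 1 ∨ σz = -1) := by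
    rcases hσ with h | h
    · exact ⟨1, by simp [h], Or.inl rfl⟩
    · exact ⟨-1, by simp [h], Or.inr rfl⟩
  obtain ⟨s₀z, hs₀z⟩ : ∃ s₀z : ℤ, s₀ = s₀z := by
    rcases hs₀ with h | h
    · exact ⟨1, by simp [h]⟩
    · exact ⟨-1, by simp [h]⟩
  -- the comparison function
  set D : ℝ → ℝ := fun t => σ * (s₀ * t + α) - La t with hD
  have hDc : Continuous D :=
    (continuous_const.mul ((continuous_const.mul continuous_id).add continuous_const)).sub hLa
  have hDinc : ∀ t, D (t + 1) = D t + ((σz * s₀z - k : ℤ) : ℝ) := fun t => by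
    simp only [hD, hk]; push_cast; rw [hσz, hs₀z]; ring
  -- pointwise: `r ∘ D` lifts `G ∘ γ`
  have key : ∀ t, circlePt (r (D t)) = G (γ t) := by
    intro t
    set φt : ℝ := s₀ * t + α with hφt
    by_cases hin : γ t ∈ ν '' (univ ×ˢ Metric.ball (0 : EuclideanSpace ℝ (Fin 3)) ε')
    · obtain ⟨⟨u, y⟩, ⟨-, hy⟩, hp⟩ := hin
      have hyε : y ∈ Metric.ball (0 : EuclideanSpace ℝ (Fin 3)) ε := Metric.ball_subset_ball hε'ε hy
      have hyε₂ : y ∈ Metric.ball (0 : EuclideanSpace ℝ (Fin 3)) ε₂ := Metric.ball_subset_ball hε'ε₂ hy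
      obtain ⟨e0, e1, e2⟩ := hT.formula u y hyε
      -- the height of `ν (u, y)` is `Q y = s`
      have hQ : y 0 ^ 2 + y 1 ^ 2 - y 2 ^ 2 = s := by
        have := hlev t
        rw [← hp, e2, ← mul_assoc, ← sq, hv2, one_mul] at this
        exact this
      rw [hQ] at e0 e1
      -- the longitude: `u = circlePt φt`
      obtain ⟨p0, p1⟩ := hpl t
      rw [← hp] at p0 p1
      obtain ⟨-, huφ⟩ := helper_degree_unit_eq_of_smul_eq hc hsq (p0.symm.trans e0) (p1.symm.trans e1)
      -- rigidity: `aC (γ t) = circlePt (σ φt - arctan y₂ / 2π)`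
      have hr := hC.rigid u y hyε₂ (by rw [hQ]; exact hs1) (by rw [hQ]; exact hs2)
      rw [hp, hLal t, ← huφ, helper_degree_rigidDir_circlePt hσ] at hr
      obtain ⟨n, hn⟩ := circlePt_eq_circlePt_iff.1 (Subtype.ext hr)
      have hDt : D t = Real.arctan (y 2) / (2 * Real.pi) + ((-n : ℤ) : ℝ) := by
        simp only [hD]; rw [hn]; push_cast; ring
      by_cases hy2 : |y 2| ≤ m₀
      · -- thin core: `r (D t) = -n + 2 y₂ / ε'`
        have habs : |D t - ((-n : ℤ) : ℝ)| ≤ Real.arctan m₀ / (2 * Real.pi) := by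
          rw [hDt, add_sub_cancel_right, abs_div, abs_of_pos (by positivity : (0 : ℝ) < 2 * Real.pi),
            div_le_div_iff_of_pos_right (by positivity)]
          rw [abs_le]
          constructor
          · rw [← Real.arctan_neg]; exact Real.arctan_mono (abs_le.1 hy2).1
          · exact Real.arctan_mono (abs_le.1 hy2).2
        rw [hr_in _ _ habs, hDt, add_sub_cancel_right,
          show 2 * Real.pi * (Real.arctan (y 2) / (2 * Real.pi)) = Real.arctan (y 2) by field_simp,
          Real.tan_arctan, ← hp, hGt u y hy]
        have hcl : max (-1 / 2) (min (1 / 2) (2 * y 2 / ε')) = 2 * y 2 / ε' := by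
          have h' := abs_le.1 hy2
          rw [min_eq_right (by rw [div_le_iff₀ hε']; linarith),
            max_eq_right (by rw [le_div_iff₀ hε']; linarith)]
        rw [hcl, show y 2 / (2 * m₀) = 2 * y 2 / ε' by rw [hm₀]; field_simp; ring,
          show ((-n : ℤ) : ℝ) + 2 * y 2 / ε' = 2 * y 2 / ε' + ((-n : ℤ) : ℝ) by ring]
        exact circlePt_add_int _ _
      · -- outside the thin core: both sides are the antipode
        rw [not_le] at hy2
        have hfar : ∀ j : ℤ, Real.arctan m₀ / (2 * Real.pi) ≤ |D t - j| := by
          intro j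
          rw [hDt]
          have hθ : Real.arctan m₀ < |Real.arctan (y 2)| := by
            rcases lt_abs.1 hy2 with h | h
            · exact lt_of_lt_of_le (Real.arctan_strictMono h) (le_abs_self _)
            · have h' : Real.arctan m₀ < Real.arctan (-(y 2)) := Real.arctan_strictMono h
              rw [Real.arctan_neg] at h'
              exact lt_of_lt_of_le h' (neg_le_abs _)
          have hθlt : |Real.arctan (y 2)| < Real.pi / 2 :=
            abs_lt.2 ⟨Real.neg_pi_div_two_lt_arctan _, Real.arctan_lt_pi_div_two _⟩
          set a : ℝ := Real.arctan (y 2) / (2 * Real.pi) with ha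
          have ha1 : |a| < 1 / 4 := by
            rw [ha, abs_div, abs_of_pos (by positivity : (0 : ℝ) < 2 * Real.pi),
              div_lt_iff₀ (by positivity)]; linarith
          have ha2 : w₁ < |a| := by
            rw [ha, hw₁, abs_div, abs_of_pos (by positivity : (0 : ℝ) < 2 * Real.pi)]
            exact div_lt_div_of_pos_right hθ (by positivity)
          rw [show a + ((-n : ℤ) : ℝ) - j = a - ((n + j : ℤ) : ℝ) by push_cast; ring]
          rcases eq_or_ne (n + j) 0 with h0 | h0
          · rw [h0]; push_cast; rw [sub_zero]; exact ha2.le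
          · have h1 : (1 : ℝ) ≤ |((n + j : ℤ) : ℝ)| := by
              rw [← Int.cast_abs]; exact_mod_cast Int.one_le_abs h0
            have := abs_sub_abs_le_abs_sub ((n + j : ℤ) : ℝ) a
            rw [abs_sub_comm] at this
            linarith [hw₁lt]
        obtain ⟨n', hn'⟩ := hr_out _ hfar
        rw [hn', helper_degree_circlePt_int_add_half, ← hp, hGt u y hy]
        rcases lt_abs.1 hy2 with h | h
        · rw [min_eq_left (by rw [le_div_iff₀ hε', hm₀] at *; linarith), max_eq_right (by norm_num)]
        · rw [min_eq_right (by rw [div_le_iff₀ hε']; rw [hm₀] at h; linarith),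
            max_eq_left (by rw [div_le_iff₀ hε']; rw [hm₀] at h; linarith)]
          rw [show (-1 / 2 : ℝ) = ((-1 : ℤ) : ℝ) + 1 / 2 by norm_num]
          exact (helper_degree_circlePt_int_add_half (-1)).symm
    · -- off the tube: `G = antipode` and `D t` is far from `ℤ` by the fibre structure
      obtain ⟨p0, p1⟩ := hpl t
      have hfar0 := helper_degree_collar X f v hv0 hv1 ε ν hT σ s₁ s₂ ε₂ ιC aC bC hC hσ ε' hε' hε'ε₂
        hε'ε (γ t) s c φt (La t) (hlev t) hs1 hs2 hsε' hc p0 p1 (hLal t) hin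
      have hmle : m₀ ≤ √((ε' ^ 2 - s) / 2) := by
        rw [hm₀, Real.le_sqrt (by positivity) (by nlinarith)]
        nlinarith
      have hfar : ∀ j : ℤ, Real.arctan m₀ / (2 * Real.pi) ≤ |D t - j| := fun j =>
        le_trans (div_le_div_of_nonneg_right (Real.arctan_mono hmle) (by positivity)) (hfar0 j)
      obtain ⟨n', hn'⟩ := hr_out _ hfar
      rw [hn', helper_degree_circlePt_int_add_half, hGo _ hin]
  -- compare increments
  have hM : Continuous fun t => r (D t) := hrc.comp hDc
  have hMk : ∀ t, r (D (t + 1)) = r (D t) + ((σz * s₀z - k : ℤ) : ℝ) := fun t => by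
    rw [hDinc, hrk]
  have e := helper_degree_increment_unique hM hLG (fun t => by rw [key, hLGl]) hMk hw
  have : ((σz * s₀z - k : ℤ) : ℝ) = w := by exact_mod_cast e
  push_cast at this
  rw [← hσz, ← hs₀z] at this
  linarith

end Summit.SmoothPoincare4.SmoothPoincare4.Cruxes.RungOne.Sketch

end
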